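import Summits.ResolutionOfSingularities.ResolutionOfSingularities.Theorems.WeightedInvariantHypersurfaceLocalGameEFTDimTwoNewton
import HarnessLib

/-!
# The ISOLATED-COEFFICIENT lemma for monomial expansions with arbitrary coefficients in a regular local ring
# (door `HypersurfaceCentreConstruction`, stmt-ResolutionOfSingularities-19897, stub `stub_keyRungGrHomLE_three`; tool for (NONREACH-K))

Helper for `stub_keyRungGrHomLE_three` (def-free, `--supports 19897`).  A complement to the tree's unit-expansion calculus
`Theorems.LocalGameEFTNewton.*` (…HypersurfaceLocalGameEFTDimTwoNewton): there, `le_weight_of_mem_weightedMonomialIdeal` reads the weighted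
filtration on expansions with UNIT coefficients, and `coeff_layer_sub_mem_maximalIdeal` reads ONE layer of an expansion with ARBITRARY
coefficients provided no exponent lies below that layer.  After a change of regular parameters `W = W' + c'·T` an honest unit expansion
becomes an expansion with arbitrary coefficients (sums `Σ_l a·C(i,l)·c'^l`), and the monomial one wants to read sits ABOVE the lowest layer.
This file supplies the missing reading:

* **`LocalGameEFTNewton.finsupp_layer_coeff_mem_maximalIdeal`** — `coeff_layer_sub_mem_maximalIdeal` with `Q = 0`, for a finsupp expansion.
* **`LocalGameEFTNewton.coeff_mem_maximalIdeal_of_isolated`** — `S` regular local, `𝔪 = (u₁, …, u_d)`, `d = dim S`, positive weights;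
  `f ≡ Σ_E l(E)·u^E (mod 𝔪^N)` with ARBITRARY coefficients; `f ∈ 𝒥_{k+1}`, `k < N`; `E₀` of weight `k` ISOLATED FROM BELOW in the support
  (every support exponent `≤ E₀` componentwise is `E₀`).  Then `l(E₀) ∈ 𝔪`.  Proof by PEELING: the lowest layer has coefficients in
  `𝔪 = (u)` (weighted quasi-regularity), and `C·u^E = Σᵢ cᵢ·u^{E+eᵢ}` (`prod_pow_add_single`) moves them one layer up; exponents below `E₀`
  never occur, so the coefficient at `E₀` is untouched until its own layer is read.

Used by …Iota3NonreachKCore (the (NONREACH-K) statement in the coordinates of the pinned successor, uniform in the translate).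

[OURS · L1 W4.3 · kernel lemma; AI work, weaker than expert review; nothing here is a statement of the manuscript under review
(Hironaka 2017, [claim: Hironaka2017, status: under-review]).]

## References

* H. Matsumura, *Commutative Ring Theory*, CUP 1987, Thm 16.2 (quasi-regularity of regular sequences). [Matsumura1987]
-/

noncomputable section

set_option linter.dupNamespace false -- mandated namespace of this single-conjunct summit

open IsLocalRing Literature.AlgebraicGeometry.Resolution

universe u

/-! ## The isolated-coefficient lemma (arbitrary coefficients) -/

namespace Summit.ResolutionOfSingularities.ResolutionOfSingularities.Theorems

namespace LocalGameEFTNewton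

variable {S : Type u} [CommRing S]

section Isolated

variable [IsRegularLocalRing S] {d : ℕ} (u : Fin d → S) (hu : Ideal.span (Set.range u) = maximalIdeal S)
  (hdim : ringKrullDim S = d) (w : Fin d → ℕ) (hw : ∀ i, 0 < w i)

include hu hdim hw in
/-- **One layer read on a finsupp expansion with arbitrary coefficients**: if `f ≡ Σ_E l(E)·u^E (mod 𝔪^N)`, all support exponents have
weight `≥ m`, `m < N` and `f ∈ 𝒥_{m+1}`, then every coefficient of weight exactly `m` lies in `𝔪`. [cite: Matsumura1987, Thm. 16.2] -/
theorem finsupp_layer_coeff_mem_maximalIdeal {f : S} (l : (Fin d → ℕ) →₀ S) {N m : ℕ}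
    (hr : f - ∑ E ∈ l.support, l E * ∏ i, u i ^ E i ∈ maximalIdeal S ^ N) (hge : ∀ E ∈ l.support, m ≤ ∑ i, w i * E i)
    (hmN : m < N) (hf : f ∈ weightedMonomialIdeal u w (m + 1)) (E : Fin d → ℕ) (hE : ∑ i, w i * E i = m) :
    l E ∈ maximalIdeal S := by
  classical
  by_cases hEs : E ∈ l.support
  · have hfQ : f - MvPolynomial.eval u (0 : MvPolynomial (Fin d) S) ∈ weightedMonomialIdeal u w (m + 1) := by
      rw [map_zero, sub_zero]; exact hf
    have h := coeff_layer_sub_mem_maximalIdeal u hu hdim w hw hr hge hmN 0 (MvPolynomial.isWeightedHomogeneous_zero S w m) hfQ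
      (Finsupp.equivFunOnFinite.symm E)
    rw [sub_zero, MvPolynomial.coeff_sum, Finset.sum_eq_single E
        (fun E' _ hne => by
          rw [MvPolynomial.coeff_monomial, if_neg]
          exact fun h => hne (Finsupp.equivFunOnFinite.symm.injective h))
        (fun h => absurd (Finset.mem_filter.mpr ⟨hEs, hE⟩) h),
      MvPolynomial.coeff_monomial, if_pos rfl] at h
    exact h
  · rw [Finsupp.notMem_support_iff.mp hEs]; exact Submodule.zero_mem _

omit [IsRegularLocalRing S] in
/-- `u^{E + eᵢ} = u^E · uᵢ`. [folklore] -/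
theorem prod_pow_add_single (E : Fin d → ℕ) (i : Fin d) :
    ∏ j, u j ^ (E + Pi.single i 1 : Fin d → ℕ) j = (∏ j, u j ^ E j) * u i := by
  classical
  have h : ∀ j, u j ^ (E + Pi.single i 1 : Fin d → ℕ) j = u j ^ E j * (if j = i then u j else 1) := fun j => by
    rw [Pi.add_apply, pow_add, Pi.single_apply]
    split_ifs with hj
    · rw [pow_one]
    · rw [pow_zero]
  simp_rw [h, Finset.prod_mul_distrib, Finset.prod_ite_eq' Finset.univ i, if_pos (Finset.mem_univ i)]

include hu hdim hw in
/-- **The isolated-coefficient lemma.**  `S` regular local with `𝔪 = (u₁,…,u_d)`, `d = dim S`, positive weights `w`; `f ≡ Σ_E l(E)·u^E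
(mod 𝔪^N)` with ARBITRARY coefficients; `f ∈ 𝒥_{k+1}(u; w)`, `k < N`; `E₀` an exponent of weight `k` ISOLATED FROM BELOW in the support of
`l` (every support exponent `≤ E₀` componentwise equals `E₀`).  Then `l(E₀) ∈ 𝔪`.  (Peeling: the coefficients of the lowest layer lie in
`𝔪 = (u)` by weighted quasi-regularity, and `C·u^E = Σᵢ cᵢ·u^{E+eᵢ}` moves them one layer up; exponents below `E₀` never occur, so the
coefficient at `E₀` is untouched until its own layer is read.) [cite: Matsumura1987, Thm. 16.2] -/
theorem coeff_mem_maximalIdeal_of_isolated {f : S} {N k : ℕ} (hkN : k < N) (hf : f ∈ weightedMonomialIdeal u w (k + 1))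
    {E₀ : Fin d → ℕ} (hE₀ : ∑ i, w i * E₀ i = k) (l : (Fin d → ℕ) →₀ S)
    (hr : f - ∑ E ∈ l.support, l E * ∏ i, u i ^ E i ∈ maximalIdeal S ^ N)
    (hiso : ∀ E ∈ l.support, E ≤ E₀ → E = E₀) : l E₀ ∈ maximalIdeal S := by
  classical
  -- induction on the number of layers below `k`
  suffices H : ∀ n m : ℕ, m + n = k → ∀ l : (Fin d → ℕ) →₀ S,
      f - ∑ E ∈ l.support, l E * ∏ i, u i ^ E i ∈ maximalIdeal S ^ N →
      (∀ E ∈ l.support, E ≤ E₀ → E = E₀) → (∀ E ∈ l.support, m ≤ ∑ i, w i * E i) → l E₀ ∈ maximalIdeal S from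
    H k 0 (by omega) l hr hiso (fun E _ => Nat.zero_le _)
  intro n
  induction n with
  | zero =>
    intro m hm l hr _ hge
    rw [add_zero] at hm
    subst hm
    exact finsupp_layer_coeff_mem_maximalIdeal u hu hdim w hw l hr hge hkN hf E₀ hE₀
  | succ n ih =>
    intro m hm l hr hiso hge
    have hmk : m < k := by omega
    have hmN : m < N := lt_trans hmk hkN
    -- the layer `m` has coefficients in `𝔪`
    set F : Finset (Fin d → ℕ) := l.support.filter (fun E => ∑ i, w i * E i = m) with hF
    have hlay : ∀ E ∈ F, l E ∈ maximalIdeal S := fun E hE =>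
      finsupp_layer_coeff_mem_maximalIdeal u hu hdim w hw l hr hge hmN (weightedMonomialIdeal_antitone u w (by omega) hf) E
        (Finset.mem_filter.mp hE).2
    -- write each such coefficient on the generators `u`
    have hc : ∀ E, ∃ c : Fin d → S, E ∈ F → ∑ i, c i * u i = l E := by
      intro E
      by_cases hE : E ∈ F
      · have h := hlay E hE
        rw [← hu] at h
        obtain ⟨c, hc⟩ := Ideal.mem_span_range_iff_exists_fun.mp h
        exact ⟨c, fun _ => hc⟩
      · exact ⟨0, fun h => absurd h hE⟩
    choose c hc using hc
    -- the peeled expansion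
    set l' : (Fin d → ℕ) →₀ S := l - ∑ E ∈ F, Finsupp.single E (l E) +
      ∑ E ∈ F, ∑ i, Finsupp.single (E + Pi.single i 1) (c E i) with hl'
    -- its value as an element of `S` is unchanged
    have hval : ∀ l₁ : (Fin d → ℕ) →₀ S, ∑ E ∈ l₁.support, l₁ E * ∏ i, u i ^ E i =
        Finsupp.linearCombination S (fun E : Fin d → ℕ => ∏ i, u i ^ E i) l₁ := fun l₁ => by
      rw [Finsupp.linearCombination_apply, Finsupp.sum]; rfl
    have hsame : ∑ E ∈ l'.support, l' E * ∏ i, u i ^ E i = ∑ E ∈ l.support, l E * ∏ i, u i ^ E i := by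
      rw [hval, hval, hl', map_add, map_sub, map_sum, map_sum]
      simp only [map_sum, Finsupp.linearCombination_single, smul_eq_mul]
      have h1 : ∀ E ∈ F, ∑ i, c E i * ∏ j, u j ^ (E + Pi.single i 1 : Fin d → ℕ) j = l E * ∏ j, u j ^ E j := fun E hE => by
        simp_rw [prod_pow_add_single u, ← mul_assoc, mul_comm (c E _) (∏ j, u j ^ E j), mul_assoc, ← Finset.mul_sum, hc E hE]
        ring
      rw [Finset.sum_congr rfl h1]
      ring
    -- pointwise description of the new coefficients
    have happly : ∀ E' : Fin d → ℕ, l' E' = l E' - (∑ E ∈ F, Finsupp.single E (l E)) E' +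
        ∑ E ∈ F, ∑ i, (Finsupp.single (E + Pi.single i 1) (c E i)) E' := fun E' => by
      rw [hl']
      simp only [Finsupp.add_apply, Finsupp.sub_apply, Finsupp.finsetSum_apply]
    have hlayer_apply : ∀ E', (∑ E ∈ F, Finsupp.single E (l E)) E' = if E' ∈ F then l E' else 0 := fun E' => by
      simp only [Finsupp.finsetSum_apply, Finsupp.single_apply, Finset.sum_ite_eq']
    have hbump_zero : ∀ E', (∀ E ∈ F, ∀ i, E + Pi.single i 1 ≠ E') →
        ∑ E ∈ F, ∑ i, (Finsupp.single (E + Pi.single i 1) (c E i)) E' = 0 := fun E' h =>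
      Finset.sum_eq_zero fun E hE => Finset.sum_eq_zero fun i _ => by rw [Finsupp.single_apply, if_neg (h E hE i)]
    -- support analysis: a new exponent is an old one off the layer, or a bumped layer exponent
    have hsupp : ∀ E' ∈ l'.support, (E' ∈ l.support ∧ E' ∉ F) ∨ ∃ E ∈ F, ∃ i, E + Pi.single i 1 = E' := by
      intro E' hE'
      by_contra hnot
      push Not at hnot
      apply Finsupp.mem_support_iff.mp hE'
      rw [happly, hbump_zero E' (fun E hE i h => (hnot.2 E hE i) h), add_zero, hlayer_apply]
      split_ifs with hE'F
      · exact sub_self _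
      · rw [sub_zero]
        by_contra hne
        exact hE'F (hnot.1 (Finsupp.mem_support_iff.mpr hne))
    have hle_bump : ∀ (E : Fin d → ℕ) (i : Fin d), E ≤ E + Pi.single i 1 := fun E i j => by
      simp only [Pi.add_apply]; exact Nat.le_add_right _ _
    have hne_bump : ∀ (E : Fin d → ℕ) (i : Fin d), E ≠ E + Pi.single i 1 := fun E i h => by
      have := congr_fun h i
      simp [Pi.single_eq_same] at this
    have hw_bump : ∀ (E : Fin d → ℕ) (i : Fin d), ∑ j, w j * (E + Pi.single i 1 : Fin d → ℕ) j = ∑ j, w j * E j + w i := fun E i => by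
      simp only [Pi.add_apply, mul_add, Finset.sum_add_distrib, Pi.single_apply, mul_ite, mul_one, mul_zero,
        Finset.sum_ite_eq', Finset.mem_univ, if_true]
    -- apply the induction hypothesis to the peeled expansion
    have hE₀F : E₀ ∉ F := fun h => by have := (Finset.mem_filter.mp h).2; omega
    have key : l' E₀ = l E₀ := by
      rw [happly, hlayer_apply, if_neg hE₀F, sub_zero, hbump_zero E₀, add_zero]
      intro E hE i h
      have hEs : E ∈ l.support := (Finset.mem_filter.mp hE).1
      have hEle : E ≤ E₀ := h ▸ hle_bump E i
      have := hiso E hEs hEle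
      rw [this] at h
      exact hne_bump E₀ i h.symm
    rw [← key]
    refine ih (m + 1) (by omega) l' (by rw [hsame]; exact hr) ?_ ?_
    · intro E' hE' hle
      rcases hsupp E' hE' with ⟨hE's, -⟩ | ⟨E, hE, i, rfl⟩
      · exact hiso E' hE's hle
      · exfalso
        have hEs : E ∈ l.support := (Finset.mem_filter.mp hE).1
        have hEE₀ : E = E₀ := hiso E hEs ((hle_bump E i).trans hle)
        have hm' := (Finset.mem_filter.mp hE).2
        rw [hEE₀] at hm'
        omega
    · intro E' hE'
      rcases hsupp E' hE' with ⟨hE's, hE'F⟩ | ⟨E, hE, i, rfl⟩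
      · have h1 := hge E' hE's
        have h2 : ∑ i, w i * E' i ≠ m := fun h => hE'F (Finset.mem_filter.mpr ⟨hE's, h⟩)
        omega
      · rw [hw_bump]
        have := (Finset.mem_filter.mp hE).2
        have := hw i
        omega

end Isolated

end LocalGameEFTNewton

end Summit.ResolutionOfSingularities.ResolutionOfSingularities.Theorems

end
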